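import Summits.ValiantsHypothesis.ValiantsHypothesis.Theorems.SymPencilSingSixClassificationZeroLine

/-!
# Route `SymPencil` — SING-SIX CLASSIFICATION, Theorem A (T6′): every `6`-dimensional linear
# subspace of `Sing Z(per₄)` lies in a cross, has two zero rows / columns, or is an exotic
# one-zero-line family `V_λ`, `V^gr` (ᵀ) — VERBATIM port, part 10/10 (`--supports`
# stmt-ValiantsHypothesis-5674 `SdcSuperquadratic`; rung currency only, nothing here bears on `VP ≠ VNP`)

PORT NOTE (val-width-5674-w2 g0′, helper mode; director-valiant R223 (a)): part 10/10 of a VERBATIM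
port of val-idea-18 g3/g4's SORRY-FREE Theorem A of `Cruxes/SdcSuperquadratic/Lines/
sing_six_classification.lean` rev 2.6 (sha256 dfb5f805c61d14b7…; here: `sixDim_perDir_list_of` … `sixDim_perDir_list_of`).
ALL mathematics and proofs are val-idea-18's (memo `SING-SIX-CLASSIFICATION.md`); the port changes
only the file split, the linear import chain, the namespace, and one-line docstrings on API lemmas.
NOT ported: the `sorry`-stubs of LIST leaves 3–5 and `sixDim_perDir_list` (leaves 3, 4 = landed
`SymPencilPerFourExoticNoSixSquares` / `SymPencilPerFourCrossFilter`; leaf 5 open).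
CUT TABLE (first–last declaration per part): 1 `…Defs` `Sing3`–`LemmaPhi` · 2 `…Transport`
`PureCore`–`finrank_kerPlane` · 3 `…Cases` `casePure_of`–`graphCond_sub` · 4 `…CaseGraph`
`caseGraph_of`–`basis_expand` · 5 `…Absorb` `productAbsorb_01`–`prodGen_apply` · 6 `…PerpPlanes`
`perpPlanes`–`pairPerm_of_T3_single` · 7 `…Toric` `E1`–`quad_kill` · 8 `…AntiBlock`
`iso_le_two`–`CrossZ` · 9 `…ZeroLine` `AntiZ`–`fiveDim_crossOrZeroLine` · 10 `…TheoremA`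
`sixDim_perDir_list_of`–`sixDim_perDir_list_of`.
Honest label: Theorem A of a line, not the crux, not the LIST; `27 ≤ sdc(per₄) ≤ 29` unchanged; stmt-5674
open; `VP ≠ VNP` not moved; no summit statement is proved here. [folklore]
-/

noncomputable section
set_option linter.dupNamespace false
set_option linter.unusedVariables false
set_option linter.unusedSectionVars false

namespace Summit.ValiantsHypothesis.ValiantsHypothesis.Theorems.SymPencilSingSixClassification

open MvPolynomial Module Literature.Computability.AlgebraicComplexity
open Literature.Barriers.CriticalPhenomena.Haruspicy (fin4_cases)
variable {K : Type*} [Field K]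

/-- **LIST — the V-side list of cell `(10,6,6)`** from the five leaves: a `6`-dimensional singular `W`
with a per-direction family of `≤ 6` squares is of `V×`-, `W_col`- or `W₂`-type (or transposed). -/
theorem sixDim_perDir_list_of [CharZero K]
    (h1 : ∀ W : Submodule K (Fin 4 × Fin 4 → K), Sing3 W → 5 ≤ finrank K W →
      InCross W ∨ (∃ i : Fin 4, ∀ x ∈ W, ∀ j : Fin 4, x (i, j) = 0) ∨
        (∃ j : Fin 4, ∀ x ∈ W, ∀ i : Fin 4, x (i, j) = 0))
    (h2 : ∀ W : Submodule K (Fin 4 × Fin 4 → K), Sing3 W → finrank K W = 6 →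
      ((∃ i : Fin 4, ∀ x ∈ W, ∀ j : Fin 4, x (i, j) = 0) ∨
        (∃ j : Fin 4, ∀ x ∈ W, ∀ i : Fin 4, x (i, j) = 0)) →
      InCross W ∨ TwoZeroRows W ∨ TwoZeroCols W ∨
        VLambdaRows W ∨ VGraphRows W ∨ VLambdaCols W ∨ VGraphCols W)
    (h3 : ∀ W : Submodule K (Fin 4 × Fin 4 → K),
      (VLambdaRows W ∨ VGraphRows W ∨ VLambdaCols W ∨ VGraphCols W) → ¬ PerDirSix W)
    (h4 : ∀ W : Submodule K (Fin 4 × Fin 4 → K), finrank K W = 6 → InCross W → PerDirSix W →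
      VCrossType W)
    (h5 : ∀ W : Submodule K (Fin 4 × Fin 4 → K), finrank K W = 6 → (TwoZeroRows W ∨ TwoZeroCols W) →
      PerDirSix W → WColType W ∨ W2Type W ∨ WColTypeT W ∨ W2TypeT W) :
    ∀ W : Submodule K (Fin 4 × Fin 4 → K), Sing3 W → finrank K W = 6 → PerDirSix W →
      VCrossType W ∨ WColType W ∨ W2Type W ∨ WColTypeT W ∨ W2TypeT W := by
  intro W hS h6 hP
  rcases sixDim_classification_of h1 h2 W hS h6 with hX | hR | hC | hE | hE | hE | hE
  · exact Or.inl (h4 W h6 hX hP)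
  · exact Or.inr (h5 W h6 (Or.inl hR) hP)
  · exact Or.inr (h5 W h6 (Or.inr hC) hP)
  · exact absurd hP (h3 W (Or.inl hE))
  · exact absurd hP (h3 W (Or.inr (Or.inl hE)))
  · exact absurd hP (h3 W (Or.inr (Or.inr (Or.inl hE))))
  · exact absurd hP (h3 W (Or.inr (Or.inr (Or.inr hE))))

end Summit.ValiantsHypothesis.ValiantsHypothesis.Theorems.SymPencilSingSixClassification

end
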